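import Summits.BirchSwinnertonDyer.BirchSwinnertonDyer.Theorems.Rank2Observatory2DescPIDCertB
import Literature.NumberTheory.CubicFields.ArtinUnitInequality
import HarnessLib

/-!
# BirchSwinnertonDyer — rank ≥ 2 observatory: the field discriminant through an integral basis, and the sharper PID certificate

HONEST FRAMING: per-curve certified theorems and census instruments; no claim on BSD in rank ≥ 2.

Generic file of the KERNEL-2DESC instrument, version 1.2 (design `b2b-bsdr2-cert-3/KERNEL-2DESC.md` §10c;
companion of `Rank2Observatory2DescOmega` and `Rank2Observatory2DescPIDCertB`). For a cubic field
`K = ℚ(θ)`, `F(θ) = 0`, and two integral elements `ω₁ = (v₀ + v₁θ + v₂θ²)/d`, `ω₂ = (v₀' + v₁'θ + v₂'θ²)/d`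
of `𝓞 K` (the integral basis of the non-monogenic field files `Rank2ObservatoryCubicFieldW<D>`):
* `discr_omega` — `disc_ℚ(1, ω₁, ω₂) = (m/d²)²·Δ(F)` with `m = v₁v₂' − v₂v₁'` (change of basis from the
  power basis `1, θ, θ²`, `Algebra.discr_of_matrix_mulVec`, `MonicCubic.discr_basis`);
* `abs_discr_le_omega` — `d⁴·|d_K| ≤ m²·|Δ(F)|` (the integral change of basis
  `abs_discr_le_abs_discr_of_ne_zero`: `disc_ℚ(1, ω₁, ω₂)` is a nonzero square multiple of `d_K`);
* `isPrincipalIdealRing_of_cert_omega` — class number one from degree-one certificates at the primes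
  `p < b` as in `isPrincipalIdealRing_of_cert_lt`, but with the Minkowski hypothesis on the SHARPER bound
  `64·m²·|Δ(F)| < 799·b²·d⁴` (i.e. on `|Δ(F)|/index²` instead of `|Δ(F)|`: `index`-fold fewer certificate primes).
Sorry-free; axioms `propext`, `Classical.choice`, `Quot.sound`.
[cite: Marcus2018, Ch. 2, Thm. 8 and Ex. 27] [cite: Marcus2018, Ch. 5, Cor. 2 of Thm. 37]
-/

-- single-conjunct summit: `Summit.BirchSwinnertonDyer.BirchSwinnertonDyer.…` repeats the name by design
set_option linter.dupNamespace false

noncomputable section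

open scoped Classical NumberField nonZeroDivisors

open Literature.NumberTheory.NumberFields Literature.NumberTheory.CubicFields Polynomial Module NumberField Ideal

namespace Summit.BirchSwinnertonDyer.BirchSwinnertonDyer.Rank2Observatory.TwoDescCubic

variable {K : Type*} [Field K] [NumberField K] {A B C : ℤ} {θ : K}

/-- The family `(1, ω₁, ω₂)` of `𝓞 K`. [folklore] -/
def omegaFamily (ω₁ ω₂ : 𝓞 K) : Fin 3 → 𝓞 K := ![1, ω₁, ω₂]

/-- **`disc_ℚ(1, ω₁, ω₂) = (m/d²)²·Δ(F)`**, `m = v₁v₂' − v₂v₁'`, for `ωᵢ = (vᵢ₀ + vᵢ₁θ + vᵢ₂θ²)/d`.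
[cite: Marcus2018, Ch. 2, Thm. 8 and Ex. 27] -/
theorem discr_omega (hirr : Irreducible (MonicCubic.polyQ A B C))
    (hθ : aeval θ (MonicCubic.poly A B C) = 0) (h3 : finrank ℚ K = 3) {d : ℕ} (hd : ((d : ℕ) : K) ≠ 0)
    {v₀ v₁ v₂ v₀' v₁' v₂' : ℤ} {ω₁ ω₂ : 𝓞 K}
    (h₁ : ((ω₁ : 𝓞 K) : K) = (((v₀ : ℤ) : K) + ((v₁ : ℤ) : K) * θ + ((v₂ : ℤ) : K) * θ ^ 2) / ((d : ℕ) : K))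
    (h₂ : ((ω₂ : 𝓞 K) : K) = (((v₀' : ℤ) : K) + ((v₁' : ℤ) : K) * θ + ((v₂' : ℤ) : K) * θ ^ 2) / ((d : ℕ) : K)) :
    Algebra.discr ℚ (fun i => ((omegaFamily ω₁ ω₂ i : 𝓞 K) : K)) =
      (((v₁ * v₂' - v₂ * v₁' : ℤ) : ℚ) / (d : ℚ) ^ 2) ^ 2 * (MonicCubic.disc A B C : ℚ) := by
  have hd' : (d : ℚ) ≠ 0 := by
    rintro h0
    apply hd
    have : ((d : ℚ) : K) = 0 := by rw [h0]; simp
    simpa using this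
  let Q : Matrix (Fin 3) (Fin 3) ℚ :=
    !![1, 0, 0; (v₀ : ℚ) / d, (v₁ : ℚ) / d, (v₂ : ℚ) / d; (v₀' : ℚ) / d, (v₁' : ℚ) / d, (v₂' : ℚ) / d]
  have hfam : (fun i => ((omegaFamily ω₁ ω₂ i : 𝓞 K) : K)) =
      (Q.map (algebraMap ℚ K)).mulVec ⇑(MonicCubic.basis hirr hθ h3) := by
    funext i
    fin_cases i
    · simp [omegaFamily, Q, Matrix.mulVec, dotProduct, Fin.sum_univ_three, MonicCubic.basis_apply]
    · simp [omegaFamily, Q, Matrix.mulVec, dotProduct, Fin.sum_univ_three, MonicCubic.basis_apply, h₁]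
      field_simp
    · simp [omegaFamily, Q, Matrix.mulVec, dotProduct, Fin.sum_univ_three, MonicCubic.basis_apply, h₂]
      field_simp
  have hdet : Q.det = ((v₁ * v₂' - v₂ * v₁' : ℤ) : ℚ) / (d : ℚ) ^ 2 := by
    simp [Q, Matrix.det_fin_three]
    field_simp
  rw [hfam, Algebra.discr_of_matrix_mulVec, MonicCubic.discr_basis hirr hθ h3, hdet]

/-- **`d⁴·|d_K| ≤ m²·|Δ(F)|`** for the integral family `(1, ω₁, ω₂)` (`m = v₁v₂' − v₂v₁' ≠ 0`): the field
discriminant divides out the square of the index of `ℤ⟨1, ω₁, ω₂⟩` in `𝓞 K`. [cite: Marcus2018, Ch. 2, Ex. 27] -/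
theorem abs_discr_le_omega (hirr : Irreducible (MonicCubic.polyQ A B C))
    (hθ : aeval θ (MonicCubic.poly A B C) = 0) (h3 : finrank ℚ K = 3) {d : ℕ} (hd : ((d : ℕ) : K) ≠ 0)
    {v₀ v₁ v₂ v₀' v₁' v₂' : ℤ} {ω₁ ω₂ : 𝓞 K}
    (h₁ : ((ω₁ : 𝓞 K) : K) = (((v₀ : ℤ) : K) + ((v₁ : ℤ) : K) * θ + ((v₂ : ℤ) : K) * θ ^ 2) / ((d : ℕ) : K))
    (h₂ : ((ω₂ : 𝓞 K) : K) = (((v₀' : ℤ) : K) + ((v₁' : ℤ) : K) * θ + ((v₂' : ℤ) : K) * θ ^ 2) / ((d : ℕ) : K))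
    (hm : v₁ * v₂' - v₂ * v₁' ≠ 0) :
    (d : ℚ) ^ 4 * |(discr K : ℚ)| ≤ ((v₁ * v₂' - v₂ * v₁' : ℤ) : ℚ) ^ 2 * |(MonicCubic.disc A B C : ℚ)| := by
  have hd' : (d : ℚ) ≠ 0 := by
    rintro h0
    apply hd
    have : ((d : ℚ) : K) = 0 := by rw [h0]; simp
    simpa using this
  have hdisc : (MonicCubic.disc A B C : ℚ) ≠ 0 := by
    have h := disc_eq_indexDet_sq_mul_discr hirr hθ h3
    have hne := indexDet_ne_zero (MonicCubic.pb hirr hθ h3) (MonicCubic.isIntegral_pb_gen hirr hθ h3)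
    have hK : discr K ≠ 0 := discr_ne_zero K
    exact_mod_cast (h ▸ mul_ne_zero (pow_ne_zero 2 hne) hK)
  have hform := discr_omega hirr hθ h3 hd h₁ h₂ (v₀ := v₀) (v₀' := v₀')
  have hne : Algebra.discr ℚ (fun i => ((omegaFamily ω₁ ω₂ i : 𝓞 K) : K)) ≠ 0 := by
    rw [hform]
    refine mul_ne_zero (pow_ne_zero 2 (div_ne_zero ?_ (pow_ne_zero 2 hd'))) hdisc
    exact_mod_cast hm
  have hle := abs_discr_le_abs_discr_of_ne_zero h3 (omegaFamily ω₁ ω₂) hne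
  have hd0 : (0 : ℚ) ≤ (d : ℚ) := by positivity
  rw [hform, abs_mul, abs_pow, abs_div, abs_pow, abs_of_nonneg hd0, div_pow, sq_abs, ← pow_mul,
    show 2 * 2 = 4 by norm_num] at hle
  have hd4 : (0 : ℚ) < (d : ℚ) ^ 4 := by positivity
  calc (d : ℚ) ^ 4 * |(discr K : ℚ)|
      ≤ (d : ℚ) ^ 4 * (((v₁ * v₂' - v₂ * v₁' : ℤ) : ℚ) ^ 2 / (d : ℚ) ^ 4 * |(MonicCubic.disc A B C : ℚ)|) :=
        mul_le_mul_of_nonneg_left hle hd4.le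
    _ = ((v₁ * v₂' - v₂ * v₁' : ℤ) : ℚ) ^ 2 * |(MonicCubic.disc A B C : ℚ)| := by
        field_simp

/-- **Class number one by degree-one certificates below the SHARPER Minkowski bound**
`64·m²·|Δ(F)| < 799·b²·d⁴` (`m²·Δ(F)/d⁴ = disc(1, ω₁, ω₂)`, a multiple of `d_K`): if for every prime `p < b`
every ring map `𝓞 K → ℤ/p` kills some prime element, `𝓞 K` is a PID.
[cite: Marcus2018, Ch. 5, Cor. 2 of Thm. 37] -/
theorem isPrincipalIdealRing_of_cert_omega (hirr : Irreducible (MonicCubic.polyQ A B C))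
    (hθ : aeval θ (MonicCubic.poly A B C) = 0) (h3 : finrank ℚ K = 3) {d : ℕ} (hd : ((d : ℕ) : K) ≠ 0)
    {v₀ v₁ v₂ v₀' v₁' v₂' : ℤ} {ω₁ ω₂ : 𝓞 K}
    (h₁ : ((ω₁ : 𝓞 K) : K) = (((v₀ : ℤ) : K) + ((v₁ : ℤ) : K) * θ + ((v₂ : ℤ) : K) * θ ^ 2) / ((d : ℕ) : K))
    (h₂ : ((ω₂ : 𝓞 K) : K) = (((v₀' : ℤ) : K) + ((v₁' : ℤ) : K) * θ + ((v₂' : ℤ) : K) * θ ^ 2) / ((d : ℕ) : K))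
    (hm : v₁ * v₂' - v₂ * v₁' ≠ 0) {b : ℕ}
    (hb : 64 * (((v₁ * v₂' - v₂ * v₁' : ℤ) : ℚ) ^ 2 * |(MonicCubic.disc A B C : ℚ)|) <
      799 * (b : ℚ) ^ 2 * (d : ℚ) ^ 4)
    (hcert : ∀ p : ℕ, p < b → p.Prime → ∀ ψ : 𝓞 K →+* ZMod p, ∃ e : 𝓞 K, ψ e = 0 ∧ Prime e) :
    IsPrincipalIdealRing (𝓞 K) := by
  have hle := abs_discr_le_omega hirr hθ h3 hd h₁ h₂ hm (v₀ := v₀) (v₀' := v₀')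
  have hd4 : (0 : ℚ) < (d : ℚ) ^ 4 := by
    have hd' : (d : ℚ) ≠ 0 := by
      rintro h0
      apply hd
      have : ((d : ℚ) : K) = 0 := by rw [h0]; simp
      simpa using this
    positivity
  have hQ : 64 * |(discr K : ℚ)| < 799 * (b : ℚ) ^ 2 := by
    by_contra hge'
    have hge := not_lt.mp hge'
    have : 799 * (b : ℚ) ^ 2 * (d : ℚ) ^ 4 ≤ 64 * (((v₁ * v₂' - v₂ * v₁' : ℤ) : ℚ) ^ 2 * |(MonicCubic.disc A B C : ℚ)|) :=
      calc 799 * (b : ℚ) ^ 2 * (d : ℚ) ^ 4 ≤ 64 * |(discr K : ℚ)| * (d : ℚ) ^ 4 :=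
            mul_le_mul_of_nonneg_right hge hd4.le
        _ = 64 * ((d : ℚ) ^ 4 * |(discr K : ℚ)|) := by ring
        _ ≤ 64 * (((v₁ * v₂' - v₂ * v₁' : ℤ) : ℚ) ^ 2 * |(MonicCubic.disc A B C : ℚ)|) :=
            mul_le_mul_of_nonneg_left hle (by norm_num)
    exact absurd hb (not_lt.mpr this)
  have hdK : 64 * |discr K| < 799 * (b : ℤ) ^ 2 := by
    have : ((64 * |discr K| : ℤ) : ℚ) < ((799 * (b : ℤ) ^ 2 : ℤ) : ℚ) := by push_cast; exact hQ
    exact_mod_cast this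
  have hM := minkowskiBound_lt h3 hdK
  refine RingOfIntegers.isPrincipalIdealRing_of_isPrincipal_of_norm_le_of_isPrime (fun I hI hIN => ?_)
  have hlt : absNorm (I : Ideal (𝓞 K)) < b := by
    have : (absNorm (I : Ideal (𝓞 K)) : ℝ) < (b : ℕ) := lt_of_le_of_lt hIN hM
    exact_mod_cast this
  have hI0 : (I : Ideal (𝓞 K)) ≠ ⊥ := nonZeroDivisors.coe_ne_zero I
  obtain ⟨p, hp, hple, J, hJ, hcases⟩ := exists_under_cases h3 hI hI0
  have hpb : p < b := lt_of_le_of_lt hple hlt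
  rcases hcases with hN | ⟨-, hNJ⟩ | ⟨-, hJT⟩
  · exact isPrincipal_of_absNorm_prime hI hp hN (hcert p hpb hp)
  · exact isPrincipal_of_cofactor hp hJ hNJ (hcert p hpb hp)
  · rw [hJT, Ideal.mul_top] at hJ
    exact ⟨⟨p, by rw [← hJ, Ideal.submodule_span_eq]⟩⟩

end Summit.BirchSwinnertonDyer.BirchSwinnertonDyer.Rank2Observatory.TwoDescCubic

end
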